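import Mathlib
import Summits.PneNP.PneNP.Theses.OverlapGapAlgebra
import Summits.PneNP.PneNP.Theorems.OverlapGapAlgebraSolvableImpliesStableSectionEtaGeOne
import Summits.PneNP.PneNP.Theorems.OverlapGapAlgebraSolvableImpliesStableSectionConstSection
import Summits.PneNP.PneNP.Theorems.OverlapGapAlgebraSolvableImpliesStableSectionLowDensity

/-!
# The crux `SolvableImpliesStableSection` (stmt-PneNP-2463) holds OFF the residual strip

Line `Sketch`, lead prover-line-stmt-PneNP-2463-c1-0, cycle 1 — a one-theorem summary of the calibrations for the
planner: the crux, with the single extra hypothesis that the parameters lie OUTSIDE the strip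
`{1/(32k²) < α} ∩ {η < 1} ∩ {ν ≤ 2^{-k}}`, is a theorem (`solvableImpliesStableSection_off_strip`):
* `α ≤ 1/(32k²)`: exact sections at low density (`solvableImpliesStableSection_of_density_le`, this line, f-free);
* `η ≥ 1`: `solvableImpliesStableSection_of_eta_ge_one` (arg-max-sat map + Efron–Stein, lead -0);
* `ν > 2^{-k}`: constant sections (`solvableImpliesStableSection_of_nu_gt`, lead -0, f-free).
(For `α ≥ 2^k` the hypothesis is moreover false — `solvableImpliesStableSection_hyp_false_of_density_ge`,
`…UnsatRegime.lean` — so inside the strip only `α < 2^k` carries content; that file is not imported here.)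
What remains of the crux is exactly skeleton v3's parked `stub_transferCore` on the strip, which inside the
Bresler–Huang window is equivalent to the failure of the hypothesis given item 2462
(`transfer_false_without_polyTime`): the target's hardness conjunct itself.
-/

set_option linter.dupNamespace false -- `Summit.PneNP.PneNP.…`: summit = sub-problem (D-0017)

namespace Summit.PneNP.PneNP.Cruxes.SolvableImpliesStableSection.Sketch

open Finset
open scoped Classical

/-- **The crux off the strip.** For every `k ≥ 3` and `α, η, ν > 0` with `α ≤ 1/(32k²)` or `η ≥ 1` or
`ν > 2^{-k}`, the implication of `SolvableImpliesStableSection` at `(k, α, η, ν)` holds (in the first and third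
case without using the hypothesis). -/
theorem solvableImpliesStableSection_off_strip (k : ℕ) (hk : 3 ≤ k) (α η ν : ℝ) (hα : 0 < α) (hη : 0 < η)
    (hν : 0 < ν) (hoff : α ≤ 1 / (32 * (k : ℝ) ^ 2) ∨ 1 ≤ η ∨ (1 / 2 : ℝ) ^ k < ν)
    (hsolv : ∃ f : List Bool → List Bool, Literature.Computability.Complexity.IsPolyTime f ∧
      ∃ ε : ℝ, 0 < ε ∧ ∃ᶠ n : ℕ in Filter.atTop, ∀ m : ℕ, m = ⌊α * n⌋₊ → ε ≤
        ((Finset.univ.filter fun Φ : Fin m → Fin k → Fin n × Bool => ∀ i, ∃ j,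
          (f (Literature.Computability.Complexity.encodingCNF.encode (List.ofFn fun a =>
            List.ofFn fun b => (((Φ a b).1 : ℕ), (Φ a b).2)))).getD (Φ i j).1 false =
              (Φ i j).2).card : ℝ) / Fintype.card (Fin m → Fin k → Fin n × Bool))
    (c : ℝ) (hc : 0 < c) :
    ∃ᶠ n : ℕ in Filter.atTop, ∀ m : ℕ, m = ⌊α * n⌋₊ →
      ∃ g : (Fin m → Fin k → Fin n × Bool) → (Fin n → Bool),
        Real.exp (-(c * n)) * Fintype.card (Fin (k + 1) → Fin m → Fin k → Fin n × Bool) ≤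
        ((Finset.univ.filter fun Ψ : Fin (k + 1) → Fin m → Fin k → Fin n × Bool =>
          let P : Fin k → ℕ → Fin m → Fin k → Fin n × Bool :=
            fun r q a b => if (a : ℕ) * k + b < q then Ψ r.succ a b else Ψ r.castSucc a b
          (∀ r : Fin k, ∀ q ≤ m * k, ((Finset.univ.filter fun i : Fin m =>
            ∀ j, g (P r q) (P r q i j).1 ≠ (P r q i j).2).card : ℝ) ≤ ν * m) ∧
          ∀ r : Fin k, ∀ q < m * k,
            (hammingDist (g (P r q)) (g (P r (q + 1))) : ℝ) ≤ η * n).card : ℝ) := by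
  have hk1 : 1 ≤ k := by omega
  rcases hoff with hlow | hη1 | hν1
  · exact solvableImpliesStableSection_of_density_le k hk α η ν hα hlow hη hν c hc
  · obtain ⟨f, -, ε, hε, hfreq⟩ := hsolv
    exact solvableImpliesStableSection_of_eta_ge_one k hk1 α η ν hα hη1 hν ⟨f, ε, hε, hfreq⟩ c hc
  · exact solvableImpliesStableSection_of_nu_gt k hk1 α η ν hα hη hν1 c hc

end Summit.PneNP.PneNP.Cruxes.SolvableImpliesStableSection.Sketch
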